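/-
Origin: expansion seat `planner-pub-hodgecm-mc-axioms-1-g14-0`, handover #W234 2026-08-20T15:53:55Z md5 1cc7b690413b (PKG 5fd5e6580421 → 1cc7b690413b; 227 l.; MECHANICAL (iib-R) rewrite v3.1 of the PKG file as it stands (11 token edits; rules R1x1+RX[h₂]x10)) (`HOME/mc/pub-hodgecm-mc-axioms-1-g14/revendor/kit-r55/stage55/HodgeCM/Model/Binders/Real34Eigenletters.lean`, md5 1cc7b690413b, 227 lines);
landed by the gen-22 packager (p-g22) in gate run 55 REPLACES the earlier landed copy of `HodgeCM/Model/Binders/Real34Eigenletters.lean` (seat copy carried the packager Origin header of an earlier run (stripped)).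
-/
/-
Origin: speedrun cell pub-hodgecm, MODEL-CONSTRUCTION sub-cell, unit pub-hodgecm-mc-binder-1-g11 (BINDER PROVER, gen 11; row 15: hypothesis (E)
«every printed local module is spanned by torus eigenvectors» DISCHARGED for the three printed place kinds), seat
prover-pub-hodgecm-mc-binder-1-g11-0, 2026-08-20.  Target in PKG: HodgeCM/Model/Binders/Real34Eigenletters.lean (NEW additive leaf; imports
`Binders/Real34CensusTAssemblyT` only).  KERNEL ONLY: 5 theorems + 2 def-valued constructors; 0 records, nothing cited, 0 `def … : Prop`,
MODEL-N ±0, E unchanged.  Nothing here is a claim of the manuscripts under adjudication.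
-/
import Summits.HodgeConjecture.HodgeCM.Model.Binders.Real34CensusTAssemblyT

/-!
# Eigenletters of the printed local modules: hypothesis (E) of `Real34CensusSideT.ofEigenletters` holds for EVERY census core

The (34) census core of mc-binder-2 prints its local modules by `printPlaces (InfinitePlace L) core.kind core.lam core.hlam vacs`, whose
place `b` carries `printLoc (lam b) (hlam b) (vac b) (kind b)` — one of pv12's THREE explicit local Fock data over the compact torus
`U(1) × U(1)` (`FockPrintPlaces`): kind `delta` (`ℂ·1`, `LocalFock.ofPrintECircle`), kind `iota` (`ℂ·det z`, `LocalFock.ofPrintICircle`),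
kind `sigma` (`ℂ[P] = span {P^k}`, `LocalFock.ofPrintMCircle`).  In all three the module is spanned by torus eigenvectors, IN THE KERNEL:

* § 1 `printLoc_ω_delta` / `printLoc_ω_iota` — at a `delta` / `iota` place EVERY vector is an eigenvector (the module is a line; pv12
  `ofPrintECircle_omega`, `ofPrintICircle_ω_apply`); `printLoc_ω_sigma_P_pow` — at a `sigma` place `P^k` is an eigenvector of weight
  `vac t · (t₁ t₂⁻¹)^k` (pv12 `ofPrintMCircle_omega_P_pow`); hence **`printLoc_span_eigen`** (all three kinds) and **`printPlaces_span_eigen`**: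
  `Submodule.span ℂ {m | ∃ cχ, ∀ t, (loc b).ω t m = cχ t • m} = ⊤` at every place of every `printPlaces …`.
* § 2 **`Gen12PinsP.Real34CensusSideT.ofMatched core hmatched`** / **`….ofMatchedT core hmatchedT`** — RUN-45 #44 `ofEigenletters` / #47
  `ofEigenlettersT` with hypothesis (E) `hspan` DISCHARGED by § 1: row 15's census-T record now rests on the (34) core and the MATCHED-letter
  hypothesis (W) / (W-T) alone.
-/

set_option autoImplicit false

noncomputable section

open MeasureTheory NumberField MulAction
open scoped Matrix InnerProductSpace TensorProduct

attribute [-instance] Quotient.instMeasurableSpace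

namespace HodgeCM.Model

open HodgeCM HodgeCM.Universe HodgeCM.Adelic HodgeCM.Model.HypCensus
open HodgeCM.PerL34 HodgeCM.PerL34.Fock HodgeCM.PerL34.Fock.PrintDict HodgeCM.PerL34.Annihilation
open Literature.NumberTheory.Weil1964
open Literature.NumberTheory.Automorphic (piSchwartzBruhat)
open Literature.NumberTheory.GelbartRogawski1991.UnitaryDualPair
open Literature.AlgebraicGeometry.HodgeTheory
open Literature.NumberTheory.Automorphic.PicardCM
open Literature.NumberTheory.Transcendental (Arapura2012_Cor_15_4_6)
open HodgeCM.Model.ThetaSpace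
open HodgeCM.Model.ArchSideTerm
open NumberField.SeesawArchTorus (toAdeles printedTorusHom printedTorusHom_apply placesEquiv)

/-! ## 1. Every printed local module is spanned by torus eigenvectors -/

section PrintedEigenletters

variable (lam : ℂ) (hlam : lam ≠ 0) (vac : Circle × Circle →* Circle)

/-- At a `delta` place every vector of the printed module `ℂ·1` is a torus eigenvector, character `vac`. -/
theorem printLoc_ω_delta (t : Circle × Circle) (m : (printLoc lam hlam vac .delta).M) :
    (printLoc lam hlam vac .delta).ω t m = ((vac t : Circle) : ℂ) • m :=
  LocalFock.ofPrintECircle_omega (fun s => ((vac s : Circle) : ℂ)) t m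

/-- At the `iota` place every vector of the printed module `ℂ·det z` is a torus eigenvector, character `χ = vac · t₁t₂`. -/
theorem printLoc_ω_iota (t : Circle × Circle) (m : (printLoc lam hlam vac .iota).M) :
    (printLoc lam hlam vac .iota).ω t m = (printLoc lam hlam vac .iota).χ t • m :=
  LocalFock.ofPrintICircle_ω_apply lam (fun s => ((vac s : Circle) : ℂ)) t m

/-- At a `sigma` place the letter `P^k ∈ ℂ[P]` is a torus eigenvector of weight `vac t · (t₁ t₂⁻¹)^k`. -/
theorem printLoc_ω_sigma_P_pow (t : Circle × Circle) (k : ℕ) :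
    (printLoc lam hlam vac .sigma).ω t (⟨P ^ k, P_pow_mem_kappaPartM k⟩ : ↥kappaPartM) =
      (((vac t : Circle) : ℂ) * (((t.1 : Circle) : ℂ) * (((t.2 : Circle) : ℂ))⁻¹) ^ k) •
        (⟨P ^ k, P_pow_mem_kappaPartM k⟩ : ↥kappaPartM) :=
  Subtype.ext (by
    rw [Submodule.coe_smul]
    exact LocalFock.ofPrintMCircle_omega_P_pow (fun s => ((vac s : Circle) : ℂ)) t k)

/-- At a swapped `sigma` place (T12) the letter `P^k ∈ ℂ[P]` is a torus eigenvector of weight `vac t · (t₂ t₁⁻¹)^k`. -/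
theorem printLoc_ω_sigmaSwap_P_pow (t : Circle × Circle) (k : ℕ) :
    (printLoc lam hlam vac .sigmaSwap).ω t (⟨P ^ k, P_pow_mem_kappaPartM k⟩ : ↥kappaPartM) =
      (((vac t : Circle) : ℂ) * (((t.2 : Circle) : ℂ) * (((t.1 : Circle) : ℂ))⁻¹) ^ k) •
        (⟨P ^ k, P_pow_mem_kappaPartM k⟩ : ↥kappaPartM) :=
  Subtype.ext (by
    rw [Submodule.coe_smul]
    exact LocalFock.ofPrintMCircleSwap_omega_P_pow (fun s => ((vac s : Circle) : ℂ)) t k)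

/-- **Every printed local module is spanned by its torus eigenvectors** (all four place kinds). -/
theorem printLoc_span_eigen : ∀ k : PlaceKind,
    Submodule.span ℂ {m : (printLoc lam hlam vac k).M |
      ∃ cχ : (printLoc lam hlam vac k).T → ℂ, ∀ t, (printLoc lam hlam vac k).ω t m = cχ t • m} = ⊤
  | .delta => Submodule.eq_top_iff'.2 fun m =>
      Submodule.subset_span ⟨fun t => ((vac t : Circle) : ℂ), fun t => printLoc_ω_delta lam hlam vac t m⟩
  | .iota => Submodule.eq_top_iff'.2 fun m =>
      Submodule.subset_span ⟨fun t => (printLoc lam hlam vac .iota).χ t, fun t => printLoc_ω_iota lam hlam vac t m⟩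
  | .sigma => by
    refine Submodule.eq_top_iff'.2 fun m => ?_
    -- the printed module at a `sigma` place IS `span {P^k}` (as a subtype); induct on the membership proof of `m`
    have key : ∀ (x : MixedModel) (hx : x ∈ Submodule.span ℂ (Set.range fun k : ℕ => P ^ k)),
        (⟨x, hx⟩ : ↥kappaPartM) ∈ Submodule.span ℂ {m : (printLoc lam hlam vac .sigma).M |
          ∃ cχ : (printLoc lam hlam vac .sigma).T → ℂ, ∀ t, (printLoc lam hlam vac .sigma).ω t m = cχ t • m} := by
      intro x hx
      induction hx using Submodule.span_induction with
      | mem y hy =>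
        obtain ⟨k, rfl⟩ := hy
        exact Submodule.subset_span
          ⟨fun t => ((vac t : Circle) : ℂ) * (((t.1 : Circle) : ℂ) * (((t.2 : Circle) : ℂ))⁻¹) ^ k,
            fun t => printLoc_ω_sigma_P_pow lam hlam vac t k⟩
      | zero => exact Submodule.zero_mem _
      | add y z hy hz ihy ihz => exact Submodule.add_mem _ ihy ihz
      | smul a y hy ih => exact Submodule.smul_mem _ a ih
    exact key m.1 m.2
  | .sigmaSwap => by
    refine Submodule.eq_top_iff'.2 fun m => ?_
    have key : ∀ (x : MixedModel) (hx : x ∈ Submodule.span ℂ (Set.range fun k : ℕ => P ^ k)),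
        (⟨x, hx⟩ : ↥kappaPartM) ∈ Submodule.span ℂ {m : (printLoc lam hlam vac .sigmaSwap).M |
          ∃ cχ : (printLoc lam hlam vac .sigmaSwap).T → ℂ, ∀ t, (printLoc lam hlam vac .sigmaSwap).ω t m = cχ t • m} := by
      intro x hx
      induction hx using Submodule.span_induction with
      | mem y hy =>
        obtain ⟨k, rfl⟩ := hy
        exact Submodule.subset_span
          ⟨fun t => ((vac t : Circle) : ℂ) * (((t.2 : Circle) : ℂ) * (((t.1 : Circle) : ℂ))⁻¹) ^ k,
            fun t => printLoc_ω_sigmaSwap_P_pow lam hlam vac t k⟩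
      | zero => exact Submodule.zero_mem _
      | add y z hy hz ihy ihz => exact Submodule.add_mem _ ihy ihz
      | smul a y hy ih => exact Submodule.smul_mem _ a ih
    exact key m.1 m.2

/-- **(E) for every printed place datum**: at every place `b` of `printPlaces RP kind lam hlam vac` the local module is spanned by
its torus eigenvectors. -/
theorem printPlaces_span_eigen (RP : Type) [Fintype RP] [DecidableEq RP] (kind : RP → PlaceKind) (lamv : RP → ℂ)
    (hlamv : ∀ b, lamv b ≠ 0) (vacs : RP → (Circle × Circle →* Circle)) (b : RP) :
    Submodule.span ℂ {m : ((printPlaces RP kind lamv hlamv vacs).loc b).M |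
      ∃ cχ : ((printPlaces RP kind lamv hlamv vacs).loc b).T → ℂ,
        ∀ t, ((printPlaces RP kind lamv hlamv vacs).loc b).ω t m = cχ t • m} = ⊤ :=
  printLoc_span_eigen (lamv b) (hlamv b) (vacs b) (kind b)

end PrintedEigenletters

/-! ## 2. The census-T record from the core and the MATCHED letters alone -/

namespace Gen12PinsP

variable
  (G : ∀ {L : CMField} {ι₁ : L →+* ℂ} (_V : HermSpace3 L ι₁) (_c : SeesawCtx L), Prop)
  (hG : ∀ {L : CMField} {ι₁ : L →+* ℂ} (V : HermSpace3 L ι₁) (c : SeesawCtx L),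
    G V c → (∀ j, 0 < (ι₁ (dW c.D j)).re) ∨ ∀ j, (ι₁ (dW c.D j)).re < 0)
  (hGR : ∀ {L : CMField} {ι₁ : L →+* ℂ} (V : HermSpace3 L ι₁) (c : SeesawCtx L),
    (cmSplittingDatum (L : Type) finProdFinEquiv (frameD V) (frameD_real V) (frameD_ne V) (dW c.D) (dW_real c.D)
      (dW_ne c.D)).CompatibleSplitting)
  (η : ∀ {L : CMField} {ι₁ : L →+* ℂ} (V : HermSpace3 L ι₁) (c : SeesawCtx L),
    CMAdelic (L : Type) (frameD V) × CMAdelic (L : Type) (dW c.D) →* ℂˣ)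
  (hη : ∀ {L : CMField} {ι₁ : L →+* ℂ} (V : HermSpace3 L ι₁) (c : SeesawCtx L),
    ∀ γU ∈ CMRat (L : Type) (frameD V), ∀ γ ∈ CMRat (L : Type) (dW c.D), η V c (γU, γ) = 1)
  (hηc : ∀ {L : CMField} {ι₁ : L →+* ℂ} (V : HermSpace3 L ι₁) (c : SeesawCtx L), Continuous fun p => ((η V c p : ℂˣ) : ℂ))
  (hGR₀ : ∀ {L : CMField} {ι₁ : L →+* ℂ} (V : HermSpace3 L ι₁) (c : SeesawCtx L),
    (cmSplittingDatum (L : Type) (e₁) (frameD V) (frameD_real V) (frameD_ne V) (lineVec (L : Type) (dW c.D 0))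
      (fun _ => dW_real c.D 0) (fun _ => dW_ne c.D 0)).CompatibleSplitting)
  (hGR₁ : ∀ {L : CMField} {ι₁ : L →+* ℂ} (V : HermSpace3 L ι₁) (c : SeesawCtx L),
    (cmSplittingDatum (L : Type) (e₁) (frameD V) (frameD_real V) (frameD_ne V) (lineVec (L : Type) (dW c.D 1))
      (fun _ => dW_real c.D 1) (fun _ => dW_ne c.D 1)).CompatibleSplitting)
  (hGR₂ : ∀ {L : CMField} {ι₁ : L →+* ℂ} (V : HermSpace3 L ι₁) (c : SeesawCtx L),
    (cmSplittingDatum (L : Type) (e₁) (frameD V) (frameD_real V) (frameD_ne V) (lineVec (L : Type) (dW' c.D 0))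
      (fun _ => dW'_real c.D 0) (fun _ => dW'_ne c.D 0)).CompatibleSplitting)
  (hGR₃ : ∀ {L : CMField} {ι₁ : L →+* ℂ} (V : HermSpace3 L ι₁) (c : SeesawCtx L),
    (cmSplittingDatum (L : Type) (e₁) (frameD V) (frameD_real V) (frameD_ne V) (lineVec (L : Type) (dW' c.D 1))
      (fun _ => dW'_real c.D 1) (fun _ => dW'_ne c.D 1)).CompatibleSplitting)
  (AG : ∀ {L : CMField} {ι₁ : L →+* ℂ} (V : HermSpace3 L ι₁) (c : SeesawCtx L), G V c → ∀ k : Fin 4,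
    ArchLineInput V (lineRepD V c.D (hGR V c) (hGR₀ V c) (hGR₁ V c) (hGR₂ V c) (hGR₃ V c) (η V c) k))

variable (hHD : exists_isReal_hodgeModel) (hI : hodgePQ_independent_of_hodgeModel)
  (h₁ : BallQuotientUniformised)  (h₃ : CMAbelianVarietyRealised)
  (h : Bool) (hA : Arapura2012_Cor_15_4_6) (μ : ∀ {L : CMField}, SeesawCtx L → Fin 4 → InfinitePlace L → ℤ)

section Context34

variable {L : CMField} {ι₁ : L →+* ℂ} (V : HermSpace3 L ι₁) (c : SeesawCtx L) (hV : IsAnisotropic L V.Hm)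

/-- **`Real34CensusSideT` from the (34) census core and (W) alone**: #44 `ofEigenletters` with (E) discharged (`printPlaces_span_eigen`). -/
def Real34CensusSideT.ofMatched (hW : IsAnisotropic L c.D.gramW)
    (core : HypCoreW ((Gen12Pins.Wg @hGR @η @hη @hηc @Gen12Pins.τSyl @Gen12Pins.TSyl @Gen12Pins.hTSyl) V c) c.D.jT₃₄ (fun w => -μ c 2 w) (fun w => -μ c 3 w))
    (hmatched : letI := core.decEq
      ∀ (χ : ((pinT hHD hI h₁ h₃ h hA (Gen12Pins.Wg @hGR @η @hη @hηc @Gen12Pins.τSyl @Gen12Pins.TSyl @Gen12Pins.hTSyl) (SInstance.SGP @G @hG @hGR @η @hη @hηc @hGR₀ @hGR₁ @hGR₂ @hGR₃ @AG) μ).t34 V c).X) (f : core.side.FinIdx) (m : ∀ b : InfinitePlace (L : Type), ((printPlaces (InfinitePlace (L : Type)) core.kind core.lam core.hlam (pinnedVacs core.kind (fun w => -μ c 2 w) (fun w => -μ c 3 w))).loc b).M)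
        (cχ : ∀ b : InfinitePlace (L : Type), ((printPlaces (InfinitePlace (L : Type)) core.kind core.lam core.hlam (pinnedVacs core.kind (fun w => -μ c 2 w) (fun w => -μ c 3 w))).loc b).T → ℂ),
        (∀ b t, ((printPlaces (InfinitePlace (L : Type)) core.kind core.lam core.hlam (pinnedVacs core.kind (fun w => -μ c 2 w) (fun w => -μ c 3 w))).loc b).ω t (m b) = cχ b t • m b) →
        (∀ t : (printPlaces (InfinitePlace (L : Type)) core.kind core.lam core.hlam (pinnedVacs core.kind (fun w => -μ c 2 w) (fun w => -μ c 3 w))).Tg, (∏ b, cχ b (t b)) * dualChar χ.1 (QuotientGroup.mk (toAdeles (L : Type) ((placesEquiv (L : Type)).symm (placesCoord (InfinitePlace (L : Type)) core.kind core.lam core.hlam (pinnedVacs core.kind (fun w => -μ c 2 w) (fun w => -μ c 3 w)) t)))) = 1) →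
        (core.side.ins f (PiTensorProduct.tprod ℂ m) : piSchwartzBruhat (↥(maximalRealSubfield L)) (Fin 6)) ∈
          admWedgeSpan hHD hI h₁ h₃ ((SInstance.SGP @G @hG @hGR @η @hη @hηc @hGR₀ @hGR₁ @hGR₂ @hGR₃ @AG) V c) hV) :
    Real34CensusSideT @G @hG @hGR @η @hη @hηc @hGR₀ @hGR₁ @hGR₂ @hGR₃ @AG hHD hI h₁ h₃ h hA @μ V c hV :=
  Real34CensusSideT.ofEigenletters @G @hG @hGR @η @hη @hηc @hGR₀ @hGR₁ @hGR₂ @hGR₃ @AG hHD hI h₁ h₃ h hA @μ V c hV hW core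
    (by
      letI := core.decEq
      exact fun b => printPlaces_span_eigen (InfinitePlace (L : Type)) core.kind core.lam core.hlam
        (pinnedVacs core.kind (fun w => -μ c 2 w) (fun w => -μ c 3 w)) b)
    hmatched

/-- **`Real34CensusSideT` from the (34) census core and (W-T) alone**: #47 `ofEigenlettersT` with (E) discharged. -/
def Real34CensusSideT.ofMatchedT (hW : IsAnisotropic L c.D.gramW)
    (core : HypCoreW ((Gen12Pins.Wg @hGR @η @hη @hηc @Gen12Pins.τSyl @Gen12Pins.TSyl @Gen12Pins.hTSyl) V c) c.D.jT₃₄ (fun w => -μ c 2 w) (fun w => -μ c 3 w))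
    (hmatchedT : letI := core.decEq
      ∀ (χ : ((pinT hHD hI h₁ h₃ h hA (Gen12Pins.Wg @hGR @η @hη @hηc @Gen12Pins.τSyl @Gen12Pins.TSyl @Gen12Pins.hTSyl) (SInstance.SGP @G @hG @hGR @η @hη @hηc @hGR₀ @hGR₁ @hGR₂ @hGR₃ @AG) μ).t34 V c).X) (f : core.side.FinIdx) (m : ∀ b : InfinitePlace (L : Type), ((printPlaces (InfinitePlace (L : Type)) core.kind core.lam core.hlam (pinnedVacs core.kind (fun w => -μ c 2 w) (fun w => -μ c 3 w))).loc b).M)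
        (cχ : ∀ b : InfinitePlace (L : Type), ((printPlaces (InfinitePlace (L : Type)) core.kind core.lam core.hlam (pinnedVacs core.kind (fun w => -μ c 2 w) (fun w => -μ c 3 w))).loc b).T → ℂ),
        (∀ b t, ((printPlaces (InfinitePlace (L : Type)) core.kind core.lam core.hlam (pinnedVacs core.kind (fun w => -μ c 2 w) (fun w => -μ c 3 w))).loc b).ω t (m b) = cχ b t • m b) →
        (∀ t : (printPlaces (InfinitePlace (L : Type)) core.kind core.lam core.hlam (pinnedVacs core.kind (fun w => -μ c 2 w) (fun w => -μ c 3 w))).Tg, (∏ b, cχ b (t b)) * dualChar χ.1 (QuotientGroup.mk (toAdeles (L : Type) ((placesEquiv (L : Type)).symm (placesCoord (InfinitePlace (L : Type)) core.kind core.lam core.hlam (pinnedVacs core.kind (fun w => -μ c 2 w) (fun w => -μ c 3 w)) t)))) = 1) →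
        ∃ Ψ : ↥((wmOf' printFact_unitaryCompact_holds ((Gen12Pins.Wg @hGR @η @hη @hηc @Gen12Pins.τSyl @Gen12Pins.TSyl @Gen12Pins.hTSyl) V c)).SK),
          (Subtype.val Ψ : piSchwartzBruhat (↥(maximalRealSubfield L)) (Fin 6)) ∈
              admWedgeSpan hHD hI h₁ h₃ ((SInstance.SGP @G @hG @hGR @η @hη @hηc @hGR₀ @hGR₁ @hGR₂ @hGR₃ @AG) V c) hV ∧
            ((pinT hHD hI h₁ h₃ h hA (Gen12Pins.Wg @hGR @η @hη @hηc @Gen12Pins.τSyl @Gen12Pins.TSyl @Gen12Pins.hTSyl) (SInstance.SGP @G @hG @hGR @η @hη @hηc @hGR₀ @hGR₁ @hGR₂ @hGR₃ @AG) μ).t34 V c).ϑ χ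
                (insM printFact_unitaryCompact_holds ((Gen12Pins.Wg @hGR @η @hη @hηc @Gen12Pins.τSyl @Gen12Pins.TSyl @Gen12Pins.hTSyl) V c) c.D.jT₃₄ core.kind core.lam core.hlam
                  (fun w => -μ c 2 w) (fun w => -μ c 3 w) core.side f (PiTensorProduct.tprod ℂ m)) =
              ((pinT hHD hI h₁ h₃ h hA (Gen12Pins.Wg @hGR @η @hη @hηc @Gen12Pins.τSyl @Gen12Pins.TSyl @Gen12Pins.hTSyl) (SInstance.SGP @G @hG @hGR @η @hη @hηc @hGR₀ @hGR₁ @hGR₂ @hGR₃ @AG) μ).t34 V c).ϑ χ Ψ) :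
    Real34CensusSideT @G @hG @hGR @η @hη @hηc @hGR₀ @hGR₁ @hGR₂ @hGR₃ @AG hHD hI h₁ h₃ h hA @μ V c hV :=
  Real34CensusSideT.ofEigenlettersT @G @hG @hGR @η @hη @hηc @hGR₀ @hGR₁ @hGR₂ @hGR₃ @AG hHD hI h₁ h₃ h hA @μ V c hV hW core
    (by
      letI := core.decEq
      exact fun b => printPlaces_span_eigen (InfinitePlace (L : Type)) core.kind core.lam core.hlam
        (pinnedVacs core.kind (fun w => -μ c 2 w) (fun w => -μ c 3 w)) b)
    hmatchedT

end Context34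

end Gen12PinsP

end HodgeCM.Model

end
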